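import Literature.MathematicalPhysics.QuantumFieldTheory.Balaban1983to89.B6MultiLevelTorusMirrorCompression
import Literature.MathematicalPhysics.QuantumFieldTheory.Balaban1983to89.B6Geom246MultiLevelTorusL0

/-!
# `Balaban1983to89.B6MultiLevelTorusMirrorDecay` — [Balaban1984PropagatorsII] Prop. 2.2 (2.67)₁ p. 234 FOR THE DIRICHLET GREEN's FUNCTION of a `…L0` family on an
# embedded mirror box ([Balaban1985BackgroundPropagators] p. 394 «Ω₀Δ′_aΩ₀ … G′»): the sup entry `|(G′λ)(x)| ≤ 2^{#mir}·C·(L^jη)²·e^{−½δ₀ d(y,y′)}·|λ|` FOLDED from p33's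
# torus census at the reflected family through the signed image identity ([Balaban1983RegularityDecay] (2.42): «it is enough to prove (2.35), (2.36) for the
# propagator G_j»), with the distance read on the ORIGINAL family's blocks (a bond path on the doubled torus folds and embeds into a bond path of the original torus)

statement-level skeleton of published theorems with citation tags; proofs where landed; nothing here is a claim about the Yang–Mills mass gap

CITATION HEADER (lean-in-tree rule).  [4] = T. Bałaban, *Propagators and renormalization transformations for lattice gauge theories. II*, Commun. Math. Phys. **96**
(1984) 223–250 [`Balaban1984PropagatorsII`], Prop. 2.2 (2.67) p. 234 («|(G′λ)(x)| … ≤ O(1)[(L^jη)², …]e^{−½δ₀d(y,y′)}|λ|, x ∈ B^j(y) … supp λ ⊂ B^{j′}(y′)»), (2.46)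
p. 231 (the distance `d(y, y′)` through admissible bonds), p. 229 («effective mass … up to +∞ outside Ω₁»); [B9] = [`Balaban1985BackgroundPropagators`] p. 394 («Ω₀Δ′_aΩ₀ …
Its inverse is denoted by G′»), Thm 3.1 (3.42) p. 397, p. 409 l. 1–5 (the cube letters «satisfy all the inequalities of Theorems 3.1–3.3»); [B4] =
[`Balaban1983RegularityDecay`] (2.42) p. 584 («Using this representation it is enough to prove (2.35), (2.36) for the propagator G_j»).

WHY THIS FILE (cell `pub-ymgap`, YM Track A D-0062, DAG node N06 = [B9], seat `pub-ymgap-dag-n06-c` g31; ROAD (I) «IMAGES» of LOCATED-31, file D3d).  D3b proved the EXACT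
identity `((Ω₀Δ′_a[F]Ω₀)⁻¹ f)(x) = Σ_{y∈X} Σ_ε s_ε G′[F′](x, σ_ε y) f(y)`.  THIS FILE turns p33's census bound for the torus Green's function `G′[F′]` of the reflected family
(`B6Prop22KLevelTorusCensusL0.prop22_supEntries_kLevelTorus` at `reflectedIdx`) into the (2.67)₁ sup bound for the Dirichlet Green's function, with the SAME threshold
«M sufficiently large» and the constants multiplied by the number of images; the exponential is read at the distance of the ORIGINAL family `F` between the blocks
`Ψ(s)`, `Ψ(s′)` under the block transfer map `Ψ = blkOf[F] ∘ emb ∘ fold`, which does not increase bond distances (the 1-Lipschitz fold and embedding of D2a/D2b turn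
every admissible bond of the doubled torus into an admissible bond, or a stay, of the original torus) and is blind to the face reflections.

WHAT IS PROVED (2 `def`s with bodies — `embPt`, `blkPsi` —; theorems; 0 sorry; 0 new named facts; standard axioms).
* §1 `exists_walk_map_of_adj`, ★ `dist_map_le` — a vertex map `Φ` between simple graphs with `Adj a b → Φ a = Φ b ∨ Adj (Φ a) (Φ b)` does not increase the graph distance
  from a vertex of a connected graph (walk induction).
* §2 THE BLOCK TRANSFER MAP: `embPt` (the embedded fold `y ↦ (fold y + g) mod N₀` as a site of the old box; `embPt_val`, `embPt_trefl`), `levR_le_succ`, `pow_dvd_sTop`,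
  `pow_dvd_N0`, `blkOf_trefl_eq_of_blkOf_eq` (the face reflections map blocks of `F′` to blocks), `blkOf_embPt_eq_of_blkOf_eq` (sites of one block of `F′` embed into one
  block of `F`), `blkPsi` (`Ψ s = blkOf[F](embPt x)` for any site `x` of `s`), `blkPsi_eq_of_blkOf` (well-defined), ★ `blkPsi_trefl` (blind to the reflections), ★★
  `dist_blkPsi_le` (`d_F(Ψ s, Ψ t) ≤ d_{F′}(s, t)`), `dist_blkPsi_le_dist_trefl` (`d_F(Ψ s, Ψ s′) ≤ d_{F′}(s, σ_ε s′)`).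
* §3 `aPrinted_succ_pos` (the printed weights are positive), `extZero_apply` (extension by zero), ★★★ `dirichlet_sup_le` — there are `M₁, δ₀, C > 0` (p33's census constants, functions of `d`, `L`) such that for EVERY `…L0` family `F`, every mirror datum
  `(k′, mir, m, g)` under the fit and margin binders, `L·M_h ≥ M₁`, every `f` on the open box supported in a block `s′` of `F′` and every box site `x` of a block `s`:
  `|((Ω₀Δ′_a[F]Ω₀)⁻¹ f)(x)| ≤ #(mirIdx mir) · (C · pref4(L^{lev s}) 0 · e^{−(δ₀/2)·d_F(Ψ s, Ψ s′)} · sup|f|)` — (2.67)₁ ∕ (3.42)₁ at `U = 1` for the Dirichlet letter.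

PROOF.  Ours: §3 = D3b `inv_compress_emb_mulVec` + the census at `reflectedIdx` for the reflected data `λ_ε(z) = f̃(σ_ε z)` (supported in the block `σ_ε s′`, same sup) +
D1-style fold `Σ_ε |s_ε|·(…)` + §2 (`d_{F′}(s, σ_ε s′) ≥ d_F(Ψ s, Ψ s′)`).

HONEST SCOPE / NOT CLAIMED.  Only the sup entry (2.67)₁ here; the gradient/Laplacian entries (2.67)₂,₆ follow the same way (`x ± e_μ` stays in the closed box, the signed
sum vanishes on the mirrors) and (2.67)₃ needs a one-block shift split — sequel D3e; the cube instance (discharging the fit/margin binders for r05's cube family and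
reading `Ψ` on `cubeFam`'s blocks) is D3c.  No new analysis: a fold of p33's kernel-checked census.  Count-neutral; N06 NOT discharged; nothing on `d = 4`, the
continuum, reflection positivity, the mass gap or Clay.  No `sorry`, no `axiom`, no `instance`, no `notation`.  Seat `pub-ymgap-dag-n06-c` g31, 2026-08-31;
`--supports stmt-QuantumFields-27239`.

RELATED IN THE TREE, NOT DUPLICATED (searched 2026-08-31, `rg` for `MirrorDecay|blkPsi|dirichlet_sup_le|dist_map_le` over `lean/Literature` + `lean/Summits`: 0 hits):
p33 `B6Geom246MultiLevelTorusL0.blkHom`/`distT_le_dist_chart` (the chart homomorphism — a graph HOMOMORPHISM; here a contraction that may collapse bonds), r05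
`B9Thm31CubeLocalFlat.thm31_cube_flat_supEntries` (the same census read for the TORUS cube letter).
-/

namespace Literature.MathematicalPhysics.QuantumFieldTheory.Balaban1983to89.B6MultiLevelTorusMirrorDecay

noncomputable section

open Finset Matrix
open Literature.MathematicalPhysics.QuantumFieldTheory.Balaban1983to89.B4Reflection242 (boxDom mem_boxDom blk)
open Literature.MathematicalPhysics.QuantumFieldTheory.Balaban1983to89.B4TorusKernel.MultiPeriod (torusSupNorm)
open Literature.MathematicalPhysics.QuantumFieldTheory.Balaban1983to89.B6MultiLevelBoxOperator (N0 bigSide aPrinted one_le_bigSide)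
open Literature.MathematicalPhysics.QuantumFieldTheory.Balaban1983to89.B6MultiLevelTorusOperator (twrap tshift mlOpT gmlT one_le_of_mem one_le_N0 N0_eq_bigSide_mul)
open Literature.MathematicalPhysics.QuantumFieldTheory.Balaban1983to89.B6MultiLevelTorusOperatorL0 (TDomains)
open Literature.MathematicalPhysics.QuantumFieldTheory.Balaban1983to89.B6Geom246MultiLevelBoxL0 (bset blkOf blkOf_val exists_blkOf_eq blkOf_eq_iff_blk lev_eq_of_blkOf_eq)
open Literature.MathematicalPhysics.QuantumFieldTheory.Balaban1983to89.B6Geom246MultiLevelTorusL0 (TouchT bondT bondT_adj connectedT)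
open Literature.MathematicalPhysics.QuantumFieldTheory.Balaban1983to89.B6Prop22KLevelTorusCensusL0 (KTIdx prop22_supEntries_kLevelTorus)
open Literature.MathematicalPhysics.QuantumFieldTheory.Balaban1983to89.B6Prop22KLevelCensusL0 (KIdx.aPrinted_windows)
open Literature.MathematicalPhysics.QuantumFieldTheory.Balaban1983to89.B6 (pref4)
open Literature.MathematicalPhysics.QuantumFieldTheory.Balaban1983to89.B4Eq242TorusMirrors
open Literature.MathematicalPhysics.QuantumFieldTheory.Balaban1983to89.B6MultiLevelTorusMirrorL0
open Literature.MathematicalPhysics.QuantumFieldTheory.Balaban1983to89.B6MultiLevelTorusMirrorDirichlet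
open Literature.MathematicalPhysics.QuantumFieldTheory.Balaban1983to89.B6MultiLevelTorusMirrorCompression
open Literature.MathematicalPhysics.QuantumFieldTheory.Balaban1983to89.B4Eq242SignedImages (signedImK)

variable {d : ℕ}

/-! ## §1  A contraction of simple graphs does not increase distances -/

section Graph

open SimpleGraph

/-- along a walk, a vertex map that sends every bond to a bond OR A STAY yields a walk of no greater length. [cite: Balaban1984PropagatorsII, (2.46) p.231 (admissible bonds and the distance d(y, y′)), bookkeeping] -/
theorem exists_walk_map_of_adj {V W : Type*} (G : SimpleGraph V) (H : SimpleGraph W) (Φ : V → W)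
    (hΦ : ∀ a b, G.Adj a b → Φ a = Φ b ∨ H.Adj (Φ a) (Φ b)) :
    ∀ {s t : V} (p : G.Walk s t), ∃ q : H.Walk (Φ s) (Φ t), q.length ≤ p.length := by
  intro s t p
  induction p with
  | nil => exact ⟨Walk.nil, le_rfl⟩
  | @cons a b c hab p ih =>
    obtain ⟨q, hq⟩ := ih
    rcases hΦ a b hab with h | h
    · exact ⟨q.copy h.symm rfl, by rw [Walk.length_copy, Walk.length_cons]; omega⟩
    · exact ⟨Walk.cons h q, by rw [Walk.length_cons, Walk.length_cons]; omega⟩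

/-- ★ **A CONTRACTION DOES NOT INCREASE THE DISTANCE**: `d_H(Φ s, Φ t) ≤ d_G(s, t)` for connected `G`. [cite: Balaban1984PropagatorsII, (2.46) p.231, bookkeeping] -/
theorem dist_map_le {V W : Type*} (G : SimpleGraph V) (H : SimpleGraph W) (Φ : V → W)
    (hΦ : ∀ a b, G.Adj a b → Φ a = Φ b ∨ H.Adj (Φ a) (Φ b)) (hG : G.Connected) (s t : V) :
    H.dist (Φ s) (Φ t) ≤ G.dist s t := by
  obtain ⟨p, hp⟩ := hG.exists_walk_length_eq_dist s t
  obtain ⟨q, hq⟩ := exists_walk_map_of_adj G H Φ hΦ p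
  exact (SimpleGraph.dist_le q).trans (hp ▸ hq)

end Graph

/-! ## §2  The block transfer map from the reflected family to the original one -/

section Transfer

variable {ℓ Mh k R : ℕ} {P : Fin (d + 1) → ℕ} {k' : ℕ} {mir : Fin (d + 1) → Bool} {m : Fin (d + 1) → ℕ} {g : Fin (d + 1) → ℤ}

/-- the EMBEDDED FOLD of a site of the new box, as a site of the old box: `y ↦ (fold y + g) mod N₀`. [cite: Balaban1984PropagatorsII, (2.1) p.224; Balaban1983RegularityDecay, (2.42) p.584, dictionary] -/
def embPt (hMh : 1 ≤ Mh) (hP : ∀ μ, 1 ≤ P μ) (g : Fin (d + 1) → ℤ)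
    (hmir : ∀ μ, mir μ = true → ((N0 ℓ Mh k' (Pref ℓ k k' P mir m)) μ : ℤ) = 2 * nMir ℓ Mh k' m μ ∧ 0 ≤ hMir ℓ Mh k' ∧ hMir ℓ Mh k' < nMir ℓ Mh k' m μ ∧ 2 ≤ nMir ℓ Mh k' m μ)
    (y : ↥(boxDom (N0 ℓ Mh k' (Pref ℓ k k' P mir m)))) : ↥(boxDom (N0 ℓ Mh k P)) :=
  ⟨B6MultiLevelTorusMirrorL0.emb (ℓ := ℓ) (Mh := Mh) (k := k) (P := P) g
      (tfold (N := (N0 ℓ Mh k' (Pref ℓ k k' P mir m))) (n := nMir ℓ Mh k' m) (h := fun _ => hMir ℓ Mh k') hmir y).1, emb_mem hMh hP g _⟩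

/-- the coordinates of the embedded fold. [cite: Balaban1984PropagatorsII, (2.1) p.224, dictionary] -/
theorem embPt_val (hMh : 1 ≤ Mh) (hP : ∀ μ, 1 ≤ P μ) (g : Fin (d + 1) → ℤ)
    (hmir : ∀ μ, mir μ = true → ((N0 ℓ Mh k' (Pref ℓ k k' P mir m)) μ : ℤ) = 2 * nMir ℓ Mh k' m μ ∧ 0 ≤ hMir ℓ Mh k' ∧ hMir ℓ Mh k' < nMir ℓ Mh k' m μ ∧ 2 ≤ nMir ℓ Mh k' m μ)
    (y : ↥(boxDom (N0 ℓ Mh k' (Pref ℓ k k' P mir m)))) :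
    (embPt (k := k) (P := P) hMh hP g hmir y).1 = B6MultiLevelTorusMirrorL0.emb (ℓ := ℓ) (Mh := Mh) (k := k) (P := P) g (tfold hmir y).1 := rfl

/-- the embedded fold is blind to the face reflections (`fold ∘ σ_ε = fold`). [cite: Balaban1983RegularityDecay, (2.42) p.584, bookkeeping] -/
theorem embPt_trefl (hMh : 1 ≤ Mh) (hP : ∀ μ, 1 ≤ P μ) (g : Fin (d + 1) → ℤ)
    (hmir : ∀ μ, mir μ = true → ((N0 ℓ Mh k' (Pref ℓ k k' P mir m)) μ : ℤ) = 2 * nMir ℓ Mh k' m μ ∧ 0 ≤ hMir ℓ Mh k' ∧ hMir ℓ Mh k' < nMir ℓ Mh k' m μ ∧ 2 ≤ nMir ℓ Mh k' m μ)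
    (ε : Fin (d + 1) → Bool) (y : ↥(boxDom (N0 ℓ Mh k' (Pref ℓ k k' P mir m)))) :
    embPt (k := k) (P := P) hMh hP g hmir (trefl hmir ε y) = embPt (k := k) (P := P) hMh hP g hmir y := by
  unfold embPt
  simp only [tfold_trefl]

variable {F : TDomains d ℓ Mh k P R} {hL : Odd (ℓ + 1)} {hM : Odd Mh} {hMh : 1 ≤ Mh} {hP : ∀ μ, 1 ≤ P μ} {hk : k' ≤ k} {hlev : ∀ x, F.lev x ≤ k'}
  {hm : ∀ μ, mir μ = true → 2 ≤ m μ} {hg : ∀ μ, sTop ℓ Mh k' ∣ g μ}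

/-- the level of a site of the reflected family is at most `k′ + 1` (for the kernel grids). [cite: Balaban1984PropagatorsII, (2.1) p.224, bookkeeping] -/
theorem levR_le_succ (hL : Odd (ℓ + 1)) (hM : Odd Mh) (hMh : 1 ≤ Mh) (hm : ∀ μ, mir μ = true → 2 ≤ m μ) (hlev : ∀ x, F.lev x ≤ k')
    (x : Fin (d + 1) → ℤ) : levR F k' mir m g (hmir_of_top (k := k) (P := P) hL hM hMh hm) x ≤ k' + 1 := by
  unfold levR
  split_ifs
  · exact (hlev _).trans (Nat.le_succ _)
  · exact Nat.zero_le _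

/-- `L^j` divides the top side `S_{k′}` for `j ≤ k′ + 1`. [cite: Balaban1984PropagatorsII, (2.1) p.224, bookkeeping] -/
theorem pow_dvd_sTop {j : ℕ} (hj : j ≤ k' + 1) : (((ℓ + 1) ^ j : ℕ) : ℤ) ∣ sTop ℓ Mh k' := by
  unfold sTop bigSide; push_cast
  rw [show ((Mh : ℤ) * ((ℓ : ℤ) + 1) ^ (k' + 1)) = ((ℓ : ℤ) + 1) ^ j * ((Mh : ℤ) * ((ℓ : ℤ) + 1) ^ (k' + 1 - j)) by
    rw [mul_left_comm, ← pow_add]; congr 2; omega]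
  exact Dvd.intro _ rfl

/-- `L^j` divides the old torus sides for `j ≤ k + 1`. [cite: Balaban1984PropagatorsII, (2.1) p.224, bookkeeping] -/
theorem pow_dvd_N0 {j : ℕ} (hj : j ≤ k + 1) (μ : Fin (d + 1)) : (((ℓ + 1) ^ j : ℕ) : ℤ) ∣ (N0 ℓ Mh k P μ : ℤ) := by
  rw [N0_eq_bigSide_mul]; unfold bigSide; push_cast
  rw [show ((Mh : ℤ) * ((ℓ : ℤ) + 1) ^ (k + 1)) * (P μ : ℤ) = ((ℓ : ℤ) + 1) ^ j * ((Mh : ℤ) * ((ℓ : ℤ) + 1) ^ (k + 1 - j) * (P μ : ℤ)) by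
    rw [show ((Mh : ℤ) * ((ℓ : ℤ) + 1) ^ (k + 1)) = ((ℓ : ℤ) + 1) ^ j * ((Mh : ℤ) * ((ℓ : ℤ) + 1) ^ (k + 1 - j)) by
      rw [mul_left_comm, ← pow_add]; congr 2; omega]; ring]
  exact Dvd.intro _ rfl

/-- ★ THE FACE REFLECTIONS MAP BLOCKS OF THE REFLECTED FAMILY TO BLOCKS (levels are mirror-symmetric, the grids `L^j` have their mirrors at block centres).
[cite: Balaban1984PropagatorsII, (2.1) p.224, (2.45) p.231; Balaban1983RegularityDecay, (2.42) p.584] -/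
theorem blkOf_trefl_eq_of_blkOf_eq (ε : Fin (d + 1) → Bool) {y y' : ↥(boxDom (N0 ℓ Mh k' (Pref ℓ k k' P mir m)))}
    (h : blkOf (reflected F k' mir m g hL hM hMh hP hk hlev hm hg).toDomains y = blkOf (reflected F k' mir m g hL hM hMh hP hk hlev hm hg).toDomains y') :
    blkOf (reflected F k' mir m g hL hM hMh hP hk hlev hm hg).toDomains (trefl (hmir_of_top (k := k) (P := P) hL hM hMh hm) ε y) = blkOf (reflected F k' mir m g hL hM hMh hP hk hlev hm hg).toDomains (trefl (hmir_of_top (k := k) (P := P) hL hM hMh hm) ε y') := by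
  have hl : levR F k' mir m g (hmir_of_top hL hM hMh hm) y.1 = levR F k' mir m g (hmir_of_top hL hM hMh hm) y'.1 := by
    have := congrArg (fun s => s.1.1) h
    simpa only [blkOf_val, TDomains.toDomains_lev, reflected_lev] using this
  have hb : blk ((ℓ + 1) ^ levR F k' mir m g (hmir_of_top hL hM hMh hm) y.1) y.1 =
      blk ((ℓ + 1) ^ levR F k' mir m g (hmir_of_top hL hM hMh hm) y.1) y'.1 := by
    have := congrArg (fun s => s.1.2) h
    simp only [blkOf_val, TDomains.toDomains_lev, reflected_lev] at this
    rw [hl] at this ⊢; exact this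
  have hb' := blk_trefl_eq_of_blk_eq (hmir_of_top (k := k) (P := P) hL hM hMh hm) (Nat.pow_pos (Nat.succ_pos ℓ))
    (hgrid_of_pow (k' := k') (m := m) hL hM hMh hm (levR_le_succ (k := k) (P := P) (g := g) hL hM hMh hm hlev y.1))
    ε (x := y) (y := y') hb
  apply Subtype.ext
  simp only [blkOf_val, TDomains.toDomains_lev, reflected_lev, levR_trefl]
  rw [hl] at hb' ⊢
  rw [hb']

/-- ★ SITES OF ONE BLOCK OF THE REFLECTED FAMILY EMBED (after folding) INTO ONE BLOCK OF THE ORIGINAL FAMILY. [cite: Balaban1984PropagatorsII, (2.1) p.224, (2.45) p.231; Balaban1983RegularityDecay, (2.42) p.584] -/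
theorem blkOf_embPt_eq_of_blkOf_eq {y y' : ↥(boxDom (N0 ℓ Mh k' (Pref ℓ k k' P mir m)))}
    (h : blkOf (reflected F k' mir m g hL hM hMh hP hk hlev hm hg).toDomains y = blkOf (reflected F k' mir m g hL hM hMh hP hk hlev hm hg).toDomains y') :
    blkOf F.toDomains (embPt (k := k) (P := P) hMh hP g (hmir_of_top (k := k) (P := P) hL hM hMh hm) y) = blkOf F.toDomains (embPt (k := k) (P := P) hMh hP g (hmir_of_top (k := k) (P := P) hL hM hMh hm) y') := by
  -- the levels of the embedded folds are the reflected levels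
  have hly : F.lev (embPt (k := k) (P := P) hMh hP g (hmir_of_top (k := k) (P := P) hL hM hMh hm) y).1 = levR F k' mir m g (hmir_of_top hL hM hMh hm) y.1 := by
    rw [embPt_val]; exact (levR_of_mem y.2).symm
  have hly' : F.lev (embPt (k := k) (P := P) hMh hP g (hmir_of_top (k := k) (P := P) hL hM hMh hm) y').1 = levR F k' mir m g (hmir_of_top hL hM hMh hm) y'.1 := by
    rw [embPt_val]; exact (levR_of_mem y'.2).symm
  have hl : levR F k' mir m g (hmir_of_top hL hM hMh hm) y.1 = levR F k' mir m g (hmir_of_top hL hM hMh hm) y'.1 := by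
    have := congrArg (fun s => s.1.1) h
    simpa only [blkOf_val, TDomains.toDomains_lev, reflected_lev] using this
  have hb : blk ((ℓ + 1) ^ levR F k' mir m g (hmir_of_top hL hM hMh hm) y.1) y.1 =
      blk ((ℓ + 1) ^ levR F k' mir m g (hmir_of_top hL hM hMh hm) y.1) y'.1 := by
    have := congrArg (fun s => s.1.2) h
    simp only [blkOf_val, TDomains.toDomains_lev, reflected_lev] at this
    rw [hl] at this ⊢; exact this
  set j := levR F k' mir m g (hmir_of_top hL hM hMh hm) y.1 with hjdef
  have hj : j ≤ k' + 1 := levR_le_succ (k := k) (P := P) (g := g) hL hM hMh hm hlev y.1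
  have hS : 0 < (ℓ + 1) ^ j := Nat.pow_pos (Nat.succ_pos ℓ)
  -- fold, then embed: same `L^j`-block
  have h1 := blk_tfold_eq_of_blk_eq (hmir_of_top (k := k) (P := P) hL hM hMh hm) hS (hgrid_of_pow (k' := k') (m := m) hL hM hMh hm hj) (x := y) (y := y') hb
  have h2 := blk_emb_eq_of_blk_eq (ℓ := ℓ) (Mh := Mh) (k := k) (P := P) hMh hP hS (fun μ => (pow_dvd_sTop (ℓ := ℓ) (Mh := Mh) hj).trans (hg μ))
    (fun μ => pow_dvd_N0 (Mh := Mh) (P := P) (by omega) μ) h1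
  -- read back as an equality of blocks
  apply Subtype.ext
  simp only [blkOf_val, TDomains.toDomains_lev]
  rw [hly, hly', ← hl, embPt_val, embPt_val, h2]

open Classical in
/-- **THE BLOCK TRANSFER MAP `Ψ`**: the block of the ORIGINAL family met by the embedded fold of (any site of) a block of the reflected family.
[cite: Balaban1984PropagatorsII, (2.45)–(2.46) p.231; Balaban1983RegularityDecay, (2.42) p.584, dictionary] -/
def blkPsi (F : TDomains d ℓ Mh k P R) (k' : ℕ) (mir : Fin (d + 1) → Bool) (m : Fin (d + 1) → ℕ) (g : Fin (d + 1) → ℤ)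
    (hL : Odd (ℓ + 1)) (hM : Odd Mh) (hMh : 1 ≤ Mh) (hP : ∀ μ, 1 ≤ P μ) (hk : k' ≤ k) (hlev : ∀ x, F.lev x ≤ k')
    (hm : ∀ μ, mir μ = true → 2 ≤ m μ) (hg : ∀ μ, sTop ℓ Mh k' ∣ g μ)
    (s : ↥(bset (reflected F k' mir m g hL hM hMh hP hk hlev hm hg).toDomains)) : ↥(bset F.toDomains) :=
  blkOf F.toDomains (embPt (k := k) (P := P) hMh hP g (hmir_of_top (k := k) (P := P) hL hM hMh hm) (Classical.choose (exists_blkOf_eq (reflected F k' mir m g hL hM hMh hP hk hlev hm hg).toDomains s)))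

/-- `Ψ` is well defined: it may be computed at ANY site of the block. [cite: Balaban1984PropagatorsII, (2.45) p.231, bookkeeping] -/
theorem blkPsi_eq_of_blkOf {s : ↥(bset (reflected F k' mir m g hL hM hMh hP hk hlev hm hg).toDomains)} {y : ↥(boxDom (N0 ℓ Mh k' (Pref ℓ k k' P mir m)))} (hy : blkOf (reflected F k' mir m g hL hM hMh hP hk hlev hm hg).toDomains y = s) :
    blkPsi F k' mir m g hL hM hMh hP hk hlev hm hg s = blkOf F.toDomains (embPt (k := k) (P := P) hMh hP g (hmir_of_top (k := k) (P := P) hL hM hMh hm) y) := by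
  unfold blkPsi
  apply blkOf_embPt_eq_of_blkOf_eq
  rw [Classical.choose_spec (exists_blkOf_eq (reflected F k' mir m g hL hM hMh hP hk hlev hm hg).toDomains s), hy]

/-- ★ `Ψ` IS BLIND TO THE FACE REFLECTIONS: the block of `σ_ε y` transfers to the same original block as the block of `y`.
[cite: Balaban1983RegularityDecay, (2.42) p.584; Balaban1984PropagatorsII, (2.45) p.231] -/
theorem blkPsi_trefl (ε : Fin (d + 1) → Bool) (y : ↥(boxDom (N0 ℓ Mh k' (Pref ℓ k k' P mir m)))) :
    blkPsi F k' mir m g hL hM hMh hP hk hlev hm hg (blkOf (reflected F k' mir m g hL hM hMh hP hk hlev hm hg).toDomains (trefl (hmir_of_top (k := k) (P := P) hL hM hMh hm) ε y)) =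
      blkPsi F k' mir m g hL hM hMh hP hk hlev hm hg (blkOf (reflected F k' mir m g hL hM hMh hP hk hlev hm hg).toDomains y) := by
  rw [blkPsi_eq_of_blkOf rfl, blkPsi_eq_of_blkOf rfl, embPt_trefl]

/-- ★★ **`Ψ` DOES NOT INCREASE BOND DISTANCES**: `d_F(Ψ s, Ψ t) ≤ d_{F′}(s, t)` — an admissible bond of the doubled torus (two blocks with sites at torus distance `≤ 1`)
folds and embeds into an admissible bond, or a stay, of the original torus (D2a `torusSupNorm_tfold_sub_le`, D2b `torusSupNorm_emb_sub_le`).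
[cite: Balaban1984PropagatorsII, (2.46) p.231 (admissible bonds, the distance d(y, y′)); Balaban1983RegularityDecay, (2.42) p.584] -/
theorem dist_blkPsi_le (s t : ↥(bset (reflected F k' mir m g hL hM hMh hP hk hlev hm hg).toDomains)) :
    (bondT F).dist (blkPsi F k' mir m g hL hM hMh hP hk hlev hm hg s) (blkPsi F k' mir m g hL hM hMh hP hk hlev hm hg t) ≤ (bondT (reflected F k' mir m g hL hM hMh hP hk hlev hm hg)).dist s t := by
  have hconn : (bondT (reflected F k' mir m g hL hM hMh hP hk hlev hm hg)).Connected := by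
    refine connectedT hMh (fun μ => ?_)
    unfold Pref
    split_ifs with hμ
    · have := hm μ hμ; omega
    · exact le_trans (hP μ) (Nat.le_mul_of_pos_left _ (Nat.pow_pos (Nat.succ_pos ℓ)))
  refine dist_map_le (bondT (reflected F k' mir m g hL hM hMh hP hk hlev hm hg)) (bondT F) (blkPsi F k' mir m g hL hM hMh hP hk hlev hm hg) (fun a b hab => ?_) hconn s t
  rw [bondT_adj] at hab
  obtain ⟨-, x, x', hx, hx', hd⟩ := hab
  by_cases he : blkPsi F k' mir m g hL hM hMh hP hk hlev hm hg a = blkPsi F k' mir m g hL hM hMh hP hk hlev hm hg b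
  · exact Or.inl he
  · refine Or.inr (bondT_adj.2 ⟨he, embPt (k := k) (P := P) hMh hP g (hmir_of_top (k := k) (P := P) hL hM hMh hm) x, embPt (k := k) (P := P) hMh hP g (hmir_of_top (k := k) (P := P) hL hM hMh hm) x',
      (blkPsi_eq_of_blkOf hx).symm, (blkPsi_eq_of_blkOf hx').symm, ?_⟩)
    rw [embPt_val, embPt_val]
    calc torusSupNorm (N0 ℓ Mh k P) _
        ≤ torusSupNorm (N0 ℓ Mh k' (Pref ℓ k k' P mir m)) ((tfold (hmir_of_top (k := k) (P := P) hL hM hMh hm) x).1 - (tfold (hmir_of_top (k := k) (P := P) hL hM hMh hm) x').1) :=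
          torusSupNorm_emb_sub_le hMh hP hk (tfold_mem_closed _ _) (tfold_mem_closed _ _)
      _ ≤ torusSupNorm (N0 ℓ Mh k' (Pref ℓ k k' P mir m)) (x.1 - x'.1) := torusSupNorm_tfold_sub_le _ x x'
      _ ≤ 1 := hd

/-- ★ hence the distance of the ORIGINAL family between the transferred blocks bounds from below the distance of the reflected family to ANY IMAGE block:
`d_F(Ψ s, Ψ s′) ≤ d_{F′}(s, σ_ε s′)`. [cite: Balaban1983RegularityDecay, (2.42) p.584; Balaban1984PropagatorsII, (2.46) p.231] -/
theorem dist_blkPsi_le_dist_trefl (s : ↥(bset (reflected F k' mir m g hL hM hMh hP hk hlev hm hg).toDomains)) (ε : Fin (d + 1) → Bool) (y : ↥(boxDom (N0 ℓ Mh k' (Pref ℓ k k' P mir m)))) :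
    (bondT F).dist (blkPsi F k' mir m g hL hM hMh hP hk hlev hm hg s) (blkPsi F k' mir m g hL hM hMh hP hk hlev hm hg (blkOf (reflected F k' mir m g hL hM hMh hP hk hlev hm hg).toDomains y)) ≤
      (bondT (reflected F k' mir m g hL hM hMh hP hk hlev hm hg)).dist s (blkOf (reflected F k' mir m g hL hM hMh hP hk hlev hm hg).toDomains (trefl (hmir_of_top (k := k) (P := P) hL hM hMh hm) ε y)) := by
  rw [← blkPsi_trefl ε y]
  exact dist_blkPsi_le _ _

end Transfer

/-! ## §3  (2.67)₁ for the Dirichlet Green's function: the census at the reflected index, folded -/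

section Decay

variable {ℓ : ℕ}

/-- the printed weights `a_{j+1}` are positive (`L ≥ 2`). [cite: Balaban1984PropagatorsII, (2.14) p.225 («a > 0»), bookkeeping] -/
theorem aPrinted_succ_pos (hℓ : 1 ≤ ℓ) (j : ℕ) : 0 < aPrinted ℓ 1 (j + 1) := by
  have h := (KIdx.aPrinted_windows hℓ).1 j
  have h1 : (1 : ℝ) ≤ ℓ := by exact_mod_cast hℓ
  have hL : (2 : ℝ) ≤ (ℓ : ℝ) + 1 := by linarith
  have hL2 : (4 : ℝ) ≤ ((ℓ : ℝ) + 1) ^ 2 := by nlinarith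
  have : 0 < 1 - ((((ℓ : ℝ) + 1)) ^ 2)⁻¹ := by
    rw [sub_pos]
    calc ((((ℓ : ℝ) + 1)) ^ 2)⁻¹ ≤ (4 : ℝ)⁻¹ := by
          exact inv_anti₀ (by norm_num) hL2
      _ < 1 := by norm_num
  exact this.trans_le h.1

/-- the extension by zero of a function on the open box to the whole new torus. [cite: Balaban1985BackgroundPropagators, p.394 («Ω₀ denotes a characteristic function of Ω₀»), dictionary] -/
theorem extZero_apply {Y : Type*} [Fintype Y] [DecidableEq Y] (X : Finset Y) (f : ↥X → ℝ) (w : Y) :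
    (∑ y : ↥X, if (y : Y) = w then f y else 0) = if h : w ∈ X then f ⟨w, h⟩ else 0 := by
  split_ifs with h
  · rw [Finset.sum_eq_single ⟨w, h⟩]
    · simp
    · intro y _ hy
      rw [if_neg]
      intro e; apply hy; exact Subtype.ext e
    · intro hh; exact absurd (Finset.mem_univ _) hh
  · refine Finset.sum_eq_zero fun y _ => ?_
    rw [if_neg]
    intro e; apply h; rw [← e]; exact y.2

variable {Mh k R : ℕ} {P : Fin (d + 1) → ℕ} {k' : ℕ} {mir : Fin (d + 1) → Bool} {m : Fin (d + 1) → ℕ} {g : Fin (d + 1) → ℤ}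

/-- ★★★ **PROPOSITION 2.2 (2.67)₁ ∕ THEOREM 3.1 (3.42)₁ AT `U = 1` FOR THE DIRICHLET GREEN's FUNCTION OF ANY `…L0` FAMILY ON AN EMBEDDED MIRROR BOX.**  With the census
constants `M₁, δ₀, C` of p33's `prop22_supEntries_kLevelTorus` (functions of `d`, `L` only): for every `…L0` family `F` (top level `≤ k′`, `1 ≤ k′ ≤ k`, odd `L`, `M_h`,
`R ≥ 2L`, `P_μ ≥ 4`), every mirror datum `(mir, m, g)` under the FIT and MARGIN binders, `M = L·M_h ≥ M₁`, every `f` on the open box supported in a block `s′` of the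
reflected family and every box site `x` of a block `s`:
`|((Ω₀Δ′_a[F]Ω₀)⁻¹ f)(x)| ≤ #(mirIdx mir) · (C · (L^{lev s})² · e^{−(δ₀/2) d_F(Ψ s, Ψ s′)} · sup_X |f|)` — the torus bound at the reflected index for each image
`λ_ε = f̃ ∘ σ_ε⁻¹` (supported in the block `σ_ε s′`, same sup), summed over the images, the distance folded onto the original family (§2).
[cite: Balaban1984PropagatorsII, Prop. 2.2 (2.67) p.234, p.229; Balaban1985BackgroundPropagators, Thm 3.1 (3.42) p.397, p.394, p.409 l.1–5; Balaban1983RegularityDecay, (2.42) p.584] -/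
theorem dirichlet_sup_le (d ℓ : ℕ) (hℓ : 1 ≤ ℓ) :
    ∃ M₁ δ₀ C : ℝ, 0 < M₁ ∧ 0 < δ₀ ∧ 0 < C ∧
      ∀ {Mh k R : ℕ} {P : Fin (d + 1) → ℕ} (F : TDomains d ℓ Mh k P R) (k' : ℕ) (mir : Fin (d + 1) → Bool) (m : Fin (d + 1) → ℕ) (g : Fin (d + 1) → ℤ)
        (hL : Odd (ℓ + 1)) (hM : Odd Mh) (hMh : 1 ≤ Mh) (hP4 : ∀ μ, 4 ≤ P μ) (hk1 : 1 ≤ k') (hk : k' ≤ k) (hlev : ∀ x, F.lev x ≤ k')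
        (hm : ∀ μ, mir μ = true → 2 ≤ m μ) (hg : ∀ μ, sTop ℓ Mh k' ∣ g μ) (hR : 2 * (ℓ + 1) ≤ R)
        (hfit : ∀ μ, mir μ = true → nMir ℓ Mh k' m μ + sTop ℓ Mh k' ≤ (N0 ℓ Mh k P μ : ℤ))
        (hmarg : ∀ x : ↥(boxDom (N0 ℓ Mh k' (Pref ℓ k k' P mir m))), x ∈ mirBoxOpen (N0 ℓ Mh k' (Pref ℓ k k' P mir m)) mir (nMir ℓ Mh k' m) (fun _ => hMir ℓ Mh k') →
          ∀ z : ↥(boxDom (N0 ℓ Mh k' (Pref ℓ k k' P mir m))), blk ((ℓ + 1) ^ (reflected F k' mir m g hL hM hMh (fun μ => le_trans (by norm_num) (hP4 μ)) hk hlev hm hg).lev x.1) z.1 = blk ((ℓ + 1) ^ (reflected F k' mir m g hL hM hMh (fun μ => le_trans (by norm_num) (hP4 μ)) hk hlev hm hg).lev x.1) x.1 →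
            z ∈ mirBoxOpen (N0 ℓ Mh k' (Pref ℓ k k' P mir m)) mir (nMir ℓ Mh k' m) (fun _ => hMir ℓ Mh k'))
        (hMbig : M₁ ≤ ((ℓ : ℝ) + 1) * Mh)
        (f : ↥(mirBoxOpen (N0 ℓ Mh k' (Pref ℓ k k' P mir m)) mir (nMir ℓ Mh k' m) (fun _ => hMir ℓ Mh k')) → ℝ) (s s' : ↥(bset (reflected F k' mir m g hL hM hMh (fun μ => le_trans (by norm_num) (hP4 μ)) hk hlev hm hg).toDomains))
        (hsupp : ∀ y : ↥(mirBoxOpen (N0 ℓ Mh k' (Pref ℓ k k' P mir m)) mir (nMir ℓ Mh k' m) (fun _ => hMir ℓ Mh k')), f y ≠ 0 → blkOf (reflected F k' mir m g hL hM hMh (fun μ => le_trans (by norm_num) (hP4 μ)) hk hlev hm hg).toDomains y.1 = s')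
        (x : ↥(mirBoxOpen (N0 ℓ Mh k' (Pref ℓ k k' P mir m)) mir (nMir ℓ Mh k' m) (fun _ => hMir ℓ Mh k'))) (hx : blkOf (reflected F k' mir m g hL hM hMh (fun μ => le_trans (by norm_num) (hP4 μ)) hk hlev hm hg).toDomains x.1 = s),
        |(((mlOpT (N0 ℓ Mh k P) ℓ k F.lev (fun j => aPrinted ℓ 1 (j + 1))).submatrix (fun v : ↥(mirBoxOpen (N0 ℓ Mh k' (Pref ℓ k k' P mir m)) mir (nMir ℓ Mh k' m) (fun _ => hMir ℓ Mh k')) => (⟨B6MultiLevelTorusMirrorL0.emb (ℓ := ℓ) (Mh := Mh) (k := k) (P := P) g v.1.1, emb_mem hMh (fun μ => le_trans (by norm_num) (hP4 μ)) g v.1.1⟩ : ↥(boxDom (N0 ℓ Mh k P)))) (fun v : ↥(mirBoxOpen (N0 ℓ Mh k' (Pref ℓ k k' P mir m)) mir (nMir ℓ Mh k' m) (fun _ => hMir ℓ Mh k')) => (⟨B6MultiLevelTorusMirrorL0.emb (ℓ := ℓ) (Mh := Mh) (k := k) (P := P) g v.1.1, emb_mem hMh (fun μ => le_trans (by norm_num)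 (hP4 μ)) g v.1.1⟩ : ↥(boxDom (N0 ℓ Mh k P)))))⁻¹ *ᵥ f) x| ≤
          (mirIdx mir).card * (C * pref4 (((ℓ : ℝ) + 1) ^ s.1.1 * 1) 0 *
            Real.exp (-(δ₀ / 2 * (((bondT F).dist ((blkPsi F k' mir m g hL hM hMh (fun μ => le_trans (by norm_num) (hP4 μ)) hk hlev hm hg) s) ((blkPsi F k' mir m g hL hM hMh (fun μ => le_trans (by norm_num) (hP4 μ)) hk hlev hm hg) s') : ℕ) : ℝ))) * ⨆ y : ↥(mirBoxOpen (N0 ℓ Mh k' (Pref ℓ k k' P mir m)) mir (nMir ℓ Mh k' m) (fun _ => hMir ℓ Mh k')), |f y|) := by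
  obtain ⟨M₁, δ₀, C, hM₁, hδ₀, hC, H⟩ := prop22_supEntries_kLevelTorus d ℓ hℓ
  refine ⟨M₁, δ₀, C, hM₁, hδ₀, hC, ?_⟩
  intro Mh k R P F k' mir m g hL hM hMh hP4 hk1 hk hlev hm hg hR hfit hmarg hMbig f s s' hsupp x hx
  classical
  have ha : ∀ j, 0 < aPrinted ℓ 1 (j + 1) := aPrinted_succ_pos hℓ
  -- the reflected index and its census bound
  set i' : KTIdx d ℓ := reflectedIdx F k' mir m g hL hM hMh hP4 hk1 hk hlev hm hg hR with hi'
  have Hi := H i' trivial hMbig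
  -- the solution formula
  rw [inv_compress_emb_mulVec (hL := hL) (hM := hM) (hMh := hMh) (hP := (fun μ => le_trans (by norm_num) (hP4 μ))) (hk := hk) (hlev := hlev) (hm := hm) (hg := hg) hfit _ ha hmarg f x]
  -- abbreviations
  set G' := gmlT (N0 ℓ Mh k' (Pref ℓ k k' P mir m)) ℓ k' (reflected F k' mir m g hL hM hMh (fun μ => le_trans (by norm_num) (hP4 μ)) hk hlev hm hg).lev (fun j => aPrinted ℓ 1 (j + 1)) with hG'
  have hGi : i'.G = G' := rfl
  set Mf : ℝ := ⨆ y : ↥(mirBoxOpen (N0 ℓ Mh k' (Pref ℓ k k' P mir m)) mir (nMir ℓ Mh k' m) (fun _ => hMir ℓ Mh k')), |f y| with hMf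
  have hMf0 : 0 ≤ Mf := le_trans (abs_nonneg (f x)) (le_ciSup (Set.finite_range fun y : ↥(mirBoxOpen (N0 ℓ Mh k' (Pref ℓ k k' P mir m)) mir (nMir ℓ Mh k' m) (fun _ => hMir ℓ Mh k')) => |f y|).bddAbove x)
  have hfle : ∀ y : ↥(mirBoxOpen (N0 ℓ Mh k' (Pref ℓ k k' P mir m)) mir (nMir ℓ Mh k' m) (fun _ => hMir ℓ Mh k')), |f y| ≤ Mf := fun y => le_ciSup (Set.finite_range fun y : ↥(mirBoxOpen (N0 ℓ Mh k' (Pref ℓ k k' P mir m)) mir (nMir ℓ Mh k' m) (fun _ => hMir ℓ Mh k')) => |f y|).bddAbove y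
  -- the extension by zero and the image data
  set ft : ↥(boxDom (N0 ℓ Mh k' (Pref ℓ k k' P mir m))) → ℝ := fun w => ∑ y : ↥(mirBoxOpen (N0 ℓ Mh k' (Pref ℓ k k' P mir m)) mir (nMir ℓ Mh k' m) (fun _ => hMir ℓ Mh k')), if (y : ↥(boxDom (N0 ℓ Mh k' (Pref ℓ k k' P mir m)))) = w then f y else 0 with hft
  have hft_apply : ∀ w, ft w = if h : w ∈ mirBoxOpen (N0 ℓ Mh k' (Pref ℓ k k' P mir m)) mir (nMir ℓ Mh k' m) (fun _ => hMir ℓ Mh k') then f ⟨w, h⟩ else 0 :=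
    fun w => extZero_apply _ f w
  have hft_abs : ∀ w, |ft w| ≤ Mf := by
    intro w; rw [hft_apply]; split_ifs with h
    · exact hfle ⟨w, h⟩
    · rw [abs_zero]; exact hMf0
  -- exchange the sums: `Σ_y (Σ_ε s_ε G′(x, σ_ε y)) f y = Σ_ε s_ε (G′ λ_ε)(x)`, `λ_ε = ft ∘ σ_ε⁻¹`
  have hswap : ∑ y : ↥(mirBoxOpen (N0 ℓ Mh k' (Pref ℓ k k' P mir m)) mir (nMir ℓ Mh k' m) (fun _ => hMir ℓ Mh k')), (∑ ε ∈ mirIdx mir, tsign ℝ mir ε * G' x.1 (trefl (hmir_of_top (k := k) (P := P) hL hM hMh hm) ε y.1)) * f y =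
      ∑ ε ∈ mirIdx mir, tsign ℝ mir ε * (G' *ᵥ (fun z => ft ((trefl (hmir_of_top (k := k) (P := P) hL hM hMh hm) ε).symm z))) x.1 := by
    have h1 : ∀ ε, (G' *ᵥ (fun z => ft ((trefl (hmir_of_top (k := k) (P := P) hL hM hMh hm) ε).symm z))) x.1 = ∑ y : ↥(mirBoxOpen (N0 ℓ Mh k' (Pref ℓ k k' P mir m)) mir (nMir ℓ Mh k' m) (fun _ => hMir ℓ Mh k')), G' x.1 (trefl (hmir_of_top (k := k) (P := P) hL hM hMh hm) ε y.1) * f y := by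
      intro ε
      rw [Matrix.mulVec, dotProduct]
      rw [← Equiv.sum_comp (trefl (hmir_of_top (k := k) (P := P) hL hM hMh hm) ε) (fun z => G' x.1 z * ft ((trefl (hmir_of_top (k := k) (P := P) hL hM hMh hm) ε).symm z))]
      simp only [Equiv.symm_apply_apply]
      -- `Σ_w G′(x, σ w) ft w = Σ_{y ∈ X} G′(x, σ y) f y`
      simp only [hft, Finset.mul_sum]
      rw [Finset.sum_comm]
      refine Finset.sum_congr rfl fun y _ => ?_
      rw [Finset.sum_eq_single y.1]
      · simp
      · intro w _ hw; rw [if_neg (fun e => hw e.symm)]; ring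
      · intro hh; exact absurd (Finset.mem_univ _) hh
    simp_rw [h1, Finset.mul_sum, Finset.sum_mul]
    rw [Finset.sum_comm]
    refine Finset.sum_congr rfl fun y _ => Finset.sum_congr rfl fun ε _ => ?_
    ring
  rw [hswap]
  -- termwise bound
  obtain ⟨y₁, hy₁⟩ := exists_blkOf_eq (reflected F k' mir m g hL hM hMh (fun μ => le_trans (by norm_num) (hP4 μ)) hk hlev hm hg).toDomains s'
  have hterm : ∀ ε ∈ mirIdx mir, |tsign ℝ mir ε * (G' *ᵥ (fun z => ft ((trefl (hmir_of_top (k := k) (P := P) hL hM hMh hm) ε).symm z))) x.1| ≤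
      C * pref4 (((ℓ : ℝ) + 1) ^ s.1.1 * 1) 0 *
        Real.exp (-(δ₀ / 2 * (((bondT F).dist ((blkPsi F k' mir m g hL hM hMh (fun μ => le_trans (by norm_num) (hP4 μ)) hk hlev hm hg) s) ((blkPsi F k' mir m g hL hM hMh (fun μ => le_trans (by norm_num) (hP4 μ)) hk hlev hm hg) s') : ℕ) : ℝ))) * Mf := by
    intro ε _
    set lam : ↥(boxDom (N0 ℓ Mh k' (Pref ℓ k k' P mir m))) → ℝ := fun z => ft ((trefl (hmir_of_top (k := k) (P := P) hL hM hMh hm) ε).symm z) with hlam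
    -- the image datum is supported in the image block
    set t : ↥(bset (reflected F k' mir m g hL hM hMh (fun μ => le_trans (by norm_num) (hP4 μ)) hk hlev hm hg).toDomains) := blkOf (reflected F k' mir m g hL hM hMh (fun μ => le_trans (by norm_num) (hP4 μ)) hk hlev hm hg).toDomains (trefl (hmir_of_top (k := k) (P := P) hL hM hMh hm) ε y₁) with ht
    have hsuppl : i'.geoT.suppIn lam t := by
      rw [B6Prop22KLevelTorusCensusL0.KTIdx.geoT_suppIn]
      intro z hz
      rw [hlam] at hz
      simp only at hz
      rw [hft_apply] at hz
      split_ifs at hz with hmem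
      · have hb := hsupp ⟨_, hmem⟩ hz
        -- `z = σ (σ⁻¹ z)` and `σ⁻¹ z ∈` block `s′ = blkOf y₁`
        have e : z = trefl (hmir_of_top (k := k) (P := P) hL hM hMh hm) ε ((trefl (hmir_of_top (k := k) (P := P) hL hM hMh hm) ε).symm z) := ((trefl (hmir_of_top (k := k) (P := P) hL hM hMh hm) ε).apply_symm_apply z).symm
        rw [ht, e]
        exact blkOf_trefl_eq_of_blkOf_eq (F := F) (hL := hL) (hM := hM) (hMh := hMh) (hP := (fun μ => le_trans (by norm_num) (hP4 μ))) (hk := hk) (hlev := hlev) (hm := hm) (hg := hg) ε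
          (hb.trans hy₁.symm)
      · exact absurd rfl hz
    -- its sup is at most `Mf`
    have hsupl : i'.geoT.supNorm lam ≤ Mf := by
      show i'.supF lam ≤ Mf
      unfold B6Prop22KLevelTorusCensusL0.KTIdx.supF
      exact ciSup_le fun z => hft_abs _
    have hsupl0 : 0 ≤ i'.geoT.supNorm lam := by
      show 0 ≤ i'.supF lam
      unfold B6Prop22KLevelTorusCensusL0.KTIdx.supF
      exact le_trans (abs_nonneg _) (le_ciSup (Set.finite_range fun z : ↥(i'.XB) => |lam z|).bddAbove x.1)
    -- the census bound at the reflected index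
    have hc := Hi 0 lam s t hsuppl
    have he0 : |(G' *ᵥ lam) x.1| ≤ i'.gp.e 0 lam s := by
      show |(G' *ᵥ lam) x.1| ≤ i'.e0 lam s
      unfold B6Prop22KLevelTorusCensusL0.KTIdx.e0
      refine le_trans (le_of_eq ?_) (le_ciSup (Set.finite_range fun z : ↥(i'.XB) => if blkOf i'.D.toDomains z = s then |(i'.G *ᵥ lam) z| else 0).bddAbove x.1)
      have hx' : blkOf i'.D.toDomains x.1 = s := hx
      simp only [hx', if_true, hGi]
      rfl
    have hlen : i'.geoT.len s = ((ℓ : ℝ) + 1) ^ s.1.1 * 1 := rfl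
    have hdist : i'.geoT.dist s t = (((bondT (reflected F k' mir m g hL hM hMh (fun μ => le_trans (by norm_num) (hP4 μ)) hk hlev hm hg)).dist s t : ℕ) : ℝ) := rfl
    rw [hlen, hdist] at hc
    -- the folded distance
    have hd : ((bondT F).dist ((blkPsi F k' mir m g hL hM hMh (fun μ => le_trans (by norm_num) (hP4 μ)) hk hlev hm hg) s) ((blkPsi F k' mir m g hL hM hMh (fun μ => le_trans (by norm_num) (hP4 μ)) hk hlev hm hg) s') : ℝ) ≤ (((bondT (reflected F k' mir m g hL hM hMh (fun μ => le_trans (by norm_num) (hP4 μ)) hk hlev hm hg)).dist s t : ℕ) : ℝ) := by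
      have := dist_blkPsi_le_dist_trefl (F := F) (hL := hL) (hM := hM) (hMh := hMh) (hP := (fun μ => le_trans (by norm_num) (hP4 μ))) (hk := hk) (hlev := hlev) (hm := hm) (hg := hg) s ε y₁
      rw [hy₁] at this
      exact_mod_cast this
    have hpref : 0 ≤ pref4 (((ℓ : ℝ) + 1) ^ s.1.1 * 1) 0 := by
      show 0 ≤ (((ℓ : ℝ) + 1) ^ s.1.1 * 1) ^ 2; positivity
    rw [abs_mul]
    calc |tsign ℝ mir ε| * |(G' *ᵥ lam) x.1| ≤ 1 * (C * pref4 (((ℓ : ℝ) + 1) ^ s.1.1 * 1) 0 *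
          Real.exp (-(δ₀ / 2 * (((bondT (reflected F k' mir m g hL hM hMh (fun μ => le_trans (by norm_num) (hP4 μ)) hk hlev hm hg)).dist s t : ℕ) : ℝ))) * i'.geoT.supNorm lam) :=
          mul_le_mul (abs_tsign_le ε) (he0.trans hc) (abs_nonneg _) zero_le_one
      _ ≤ C * pref4 (((ℓ : ℝ) + 1) ^ s.1.1 * 1) 0 *
          Real.exp (-(δ₀ / 2 * (((bondT F).dist ((blkPsi F k' mir m g hL hM hMh (fun μ => le_trans (by norm_num) (hP4 μ)) hk hlev hm hg) s) ((blkPsi F k' mir m g hL hM hMh (fun μ => le_trans (by norm_num) (hP4 μ)) hk hlev hm hg) s') : ℕ) : ℝ))) * Mf := by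
          rw [one_mul]
          have hCp : 0 ≤ C * pref4 (((ℓ : ℝ) + 1) ^ s.1.1 * 1) 0 := mul_nonneg hC.le hpref
          apply mul_le_mul _ hsupl hsupl0 (mul_nonneg hCp (Real.exp_nonneg _))
          apply mul_le_mul_of_nonneg_left _ hCp
          apply Real.exp_le_exp.2
          have : δ₀ / 2 * (((bondT F).dist ((blkPsi F k' mir m g hL hM hMh (fun μ => le_trans (by norm_num) (hP4 μ)) hk hlev hm hg) s) ((blkPsi F k' mir m g hL hM hMh (fun μ => le_trans (by norm_num) (hP4 μ)) hk hlev hm hg) s') : ℕ) : ℝ) ≤ δ₀ / 2 * (((bondT (reflected F k' mir m g hL hM hMh (fun μ => le_trans (by norm_num) (hP4 μ)) hk hlev hm hg)).dist s t : ℕ) : ℝ) :=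
            mul_le_mul_of_nonneg_left hd (by positivity)
          linarith
  calc |∑ ε ∈ mirIdx mir, tsign ℝ mir ε * (G' *ᵥ (fun z => ft ((trefl (hmir_of_top (k := k) (P := P) hL hM hMh hm) ε).symm z))) x.1|
      ≤ ∑ ε ∈ mirIdx mir, |tsign ℝ mir ε * (G' *ᵥ (fun z => ft ((trefl (hmir_of_top (k := k) (P := P) hL hM hMh hm) ε).symm z))) x.1| := Finset.abs_sum_le_sum_abs _ _
    _ ≤ ∑ ε ∈ mirIdx mir, C * pref4 (((ℓ : ℝ) + 1) ^ s.1.1 * 1) 0 *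
          Real.exp (-(δ₀ / 2 * (((bondT F).dist ((blkPsi F k' mir m g hL hM hMh (fun μ => le_trans (by norm_num) (hP4 μ)) hk hlev hm hg) s) ((blkPsi F k' mir m g hL hM hMh (fun μ => le_trans (by norm_num) (hP4 μ)) hk hlev hm hg) s') : ℕ) : ℝ))) * Mf := Finset.sum_le_sum hterm
    _ = (mirIdx mir).card * (C * pref4 (((ℓ : ℝ) + 1) ^ s.1.1 * 1) 0 *
          Real.exp (-(δ₀ / 2 * (((bondT F).dist ((blkPsi F k' mir m g hL hM hMh (fun μ => le_trans (by norm_num) (hP4 μ)) hk hlev hm hg) s) ((blkPsi F k' mir m g hL hM hMh (fun μ => le_trans (by norm_num) (hP4 μ)) hk hlev hm hg) s') : ℕ) : ℝ))) * Mf) := by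
        rw [Finset.sum_const, nsmul_eq_mul]

end Decay

end

end Literature.MathematicalPhysics.QuantumFieldTheory.Balaban1983to89.B6MultiLevelTorusMirrorDecay
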